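import Literature.AlgebraicGeometry.Motives.CartierDivisorCocycleIntegral
import Literature.AlgebraicGeometry.Motives.CartierDivisorCech
import Literature.AlgebraicGeometry.Motives.FibreBaseChange
import HarnessLib

/-!
# Sections of `𝒪(D)` over an affine open of `X ×_K T`, base-changed to `κ(t)`, are the sections of
# `𝒪(D_t)` over the fibre open (Görtz–Wedhorn I, (11.16) with II, (23.28.5) in degree `0`)

`Motives/FibreBaseChange` proves the affine base change of *functions* to a fibre of
`pr_T : X ×_K T → T`: for affine opens `V ∋ t` of `T` and `W ⊆ pr_T⁻¹V`,
`κ(t) ⊗_{Γ(V, 𝒪_T)} Γ(W, 𝒪_{X ×_K T}) ⥲ Γ(W_t, 𝒪_{X_t})` (`fibreSectionsEquiv`, `W_t` the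
preimage of `W` under the fibre inclusion `fibreι X T t : X_t → X ×_K T`). This file adds the
line bundle `𝒪(D)` of a Cartier divisor `D` on the integral scheme `Y = X ×_K T`
(`Motives/CartierDivisor`), i.e. the termwise content of the base change
`Č•(𝔚, 𝒪(D)) ⊗_{Γ(V, 𝒪_T)} κ(t)` of the Čech complex of `Motives/CartierDivisorCech`, which is what
the named fact `cechComplex_h0_fibre` of `Motives/GrothendieckComplexCech` (Görtz–Wedhorn II,
(23.28.5) in degree `0` for `𝓕 = 𝒪(D)`) is made of:

* for any morphism `ι : F → Y` of integral schemes: `CartierDivisor.fibreFn D ι s = ι^♯(f_{i₀} s)`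
  — the restriction of rational sections of `𝒪_Y(D)` to `F` in the model
  `ι^*𝒪_Y(D) ≅ 𝒪_F(D_ι)`, `D_ι = classPullback D ι = ι^*(D - div f_{i₀})`
  (`Motives/CartierDivisorClassPullback`; `i₀ = chartAt D (ι η_F)`, the chart chosen there;
  Görtz–Wedhorn I, (11.16): "`f^*𝒪(D) ≅ 𝒪(f^*D)`"); it is `CartierDivisor.restrictFibre` of
  `Motives/SeesawGrauert` for the fibres of `X ×_K T → T` (that file cannot be imported next to
  `Motives/SemicontinuityGrothendieckComplex`, whence the neutral restatement), with the charts
  and equations of `classPullback D ι` made explicit (`classPullback_U`, `classPullback_f`) and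
  `IsSectionOn.fibreFn`: sections over `W ∋ ι(η_F)` restrict to sections of `𝒪_F(D_ι)` over `ι⁻¹W`;
* `CartierDivisor.fibreSectionsOnEquiv` — **the main result**: for `W ⊆ pr_T⁻¹V ∩ U_c` affine with
  `y_t := fibreι(η_{X_t}) ∈ W`, a `κ(t)`-linear isomorphism
  `κ(t) ⊗_{Γ(V, 𝒪_T)} Γ(W, 𝒪_Y(D)) ≅ Γ(W_t, 𝒪_{X_t}(D_t))` (`CartierDivisor.sectionsOn` of
  `Motives/CartierDivisorSectionsOn` on both sides; `Γ(V, 𝒪_T)` acts on `K(Y)` through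
  `CartierDivisor.baseAlgebra` of `Motives/CartierDivisorCech` and on `κ(t)` by evaluation,
  `evalAlgebra`; `κ(t)` acts on `K(X_t)` through `fibreOverResidueField`), the composite of the
  trivialisation `Γ(W, 𝒪_Y(D)) = f_c⁻¹ Γ(W, 𝒪_Y)` (`CartierDivisor.sectionsOnEquiv`), the affine
  base change `fibreSectionsEquiv` and the trivialisation
  `Γ(W_t, 𝒪_{X_t}(D_t)) = ι^♯(f_c/f_{i₀})⁻¹ Γ(W_t, 𝒪_{X_t})`; on elements it is
  `c ⊗ s ↦ c · ι^♯(f_{i₀} s)` (`coe_fibreSectionsOnEquiv_tmul`) — independent of `W` and of the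
  chart `c`, hence compatible with the Čech differentials —, and
  `subsingleton_tensorProduct_sectionsOn`: if `y_t ∉ W` then `W_t = ∅` and
  `κ(t) ⊗ Γ(W, 𝒪_Y(D)) = 0`.

Also proved: additivity of `RatFn.pullbackFn` on `𝒪_{Y, ι(η_F)}` (`pullbackFn_add`, missing next to
`pullbackFn_mul` in `Motives/CartierDivisorClassPullback`). Mathlib searched and used (pin):
`LinearEquiv.baseChange`, `LinearEquiv.baseChange_tmul`, `AlgEquiv.toLinearEquiv`,
`TopCat.Sheaf.isTerminalOfEqEmpty`, `CommRingCat.subsingleton_of_isTerminal`; Mathlib has no `𝒪(D)`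
and no statement on sections of line bundles on fibres. In this tree (used): `fibreSectionsEquiv`,
`fibreSectionsEquiv_tmul`, `evalAlgebra`, `prSecAlgebra`, `fibreSecAlgebra` (`Motives/FibreBaseChange`),
`RatFn.ofSection_appLE` (`Motives/CartierDivisorCocycleIntegral`), `CartierDivisor.sectionsOnEquiv`
(`Motives/CartierDivisorSectionsOn`), `CartierDivisor.baseAlgebra` (`Motives/CartierDivisorCech`).

## References

* U. Görtz, T. Wedhorn, *Algebraic Geometry I: Schemes*, 2nd ed., Springer Spektrum (2020),
  doi:10.1007/978-3-658-30733-2: (11.9), p. 374 (`Γ(V, 𝒪_X(D))`, `𝒪_X(D)|_{U_i} = f_i⁻¹𝒪_{U_i}`);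
  (11.16), Def. 11.49, p. 392 (`f^*𝒪(D) ≅ 𝒪(f^*D)`); Prop. 12.6, p. 405 (base change of direct
  images, affine case) (read via the held copy). [GortzWedhorn2020]
* U. Görtz, T. Wedhorn, *Algebraic Geometry II: Cohomology of Schemes*, Springer Spektrum (2023),
  doi:10.1007/978-3-658-43031-3: proof of Thm. 22.90, p. 388; (23.28.5), p. 482 (read via the
  held copy). [GortzWedhorn2023]
-/

universe u

open CategoryTheory CategoryTheory.Limits AlgebraicGeometry TopologicalSpace Opposite TensorProduct
open MonoidalCategory CartesianMonoidalCategory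

noncomputable section

namespace Literature.AlgebraicGeometry.Motives

/-! ### Pullback of rational functions: additivity -/

namespace RatFn

variable {X' X : Scheme.{u}} [IsIntegral X] [IsIntegral X'] (g : X' ⟶ X)

/-- `pullbackFn` is additive on `𝒪_{X, g(η)}`. [folklore] -/
theorem pullbackFn_add {a b : X.functionField} (ha : IsRegularAt (g (genericPoint X')) a)
    (hb : IsRegularAt (g (genericPoint X')) b) :
    pullbackFn g (a + b) = pullbackFn g a + pullbackFn g b := by
  obtain ⟨s, rfl⟩ := ha
  obtain ⟨t, rfl⟩ := hb
  rw [← map_add, pullbackFn_eq _ rfl, pullbackFn_eq _ rfl, pullbackFn_eq _ rfl, map_add, map_add]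

/-- `pullbackFn g 0 = 0`. [folklore] -/
theorem pullbackFn_zero : pullbackFn g (0 : X.functionField) = 0 := by
  rw [pullbackFn_eq (0 : X.presheaf.stalk _) (map_zero _), map_zero, map_zero]

end RatFn

/-! ### Sections of `𝒪(D)` over an affine open, base-changed to a point, are the sections of
`𝒪(D_τ)` over the fibre open -/

namespace CartierDivisor

open RatFn

section ChartAt

variable {Y : Scheme.{u}} [IsIntegral Y] (D : CartierDivisor Y)

/-- A chart of `D` at the point `y` (chosen once and for all; the choice made by
`CartierDivisor.moveAway`, hence by `CartierDivisor.classPullback`). [folklore] -/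
def chartAt (y : Y) : D.ι := (D.covers y).choose

/-- `y ∈ U_{chartAt y}`. [folklore] -/
theorem mem_U_chartAt (y : Y) : y ∈ D.U (D.chartAt y) := (D.covers y).choose_spec

variable {F : Scheme.{u}} [IsIntegral F] (ι : F ⟶ Y)

/-- **Restriction of rational sections of `𝒪_Y(D)` along `ι : F → Y`** in the model
`ι^*𝒪_Y(D) ≅ 𝒪_F(D_ι)`, `D_ι = classPullback D ι = ι^*(D - div f_{i₀})` (`i₀` the chart at
`y₀ = ι(η_F)`): `s ↦ ι^♯(f_{i₀} s)`, the pullback of the corresponding section `f_{i₀} s` of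
`𝒪_Y(D - div f_{i₀})` (meaningful when `f_{i₀} s` is regular at `y₀`, e.g. `s` a section of `𝒪_Y(D)`
near `y₀`). For the fibres of `X ×_K T → T` this is `CartierDivisor.restrictFibre` of
`Motives/SeesawGrauert`. [folklore] -/
def fibreFn (s : Y.functionField) : F.functionField :=
  pullbackFn ι (D.f (D.chartAt (ι (genericPoint F))) * s)

/-- The charts of `classPullback D ι`: `ι⁻¹(U_j ∩ Y)` for the charts `U_j ∋ ι(η_F)` of `D`. [folklore] -/
theorem classPullback_U (j : (D.classPullback ι).ι) :
    (D.classPullback ι).U j = ι ⁻¹ᵁ (D.U j.1.1 ⊓ ⊤) := rfl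

/-- The local equations of `classPullback D ι`: `ι^♯(f_j / f_{i₀})`. [folklore] -/
theorem classPullback_f (j : (D.classPullback ι).ι) :
    (D.classPullback ι).f j =
      pullbackFn ι (D.f j.1.1 * (D.f (D.chartAt (ι (genericPoint F))))⁻¹) := rfl

/-- `ι(η_F)` lies in the chart `U_j` of `D` for every chart `j` of `classPullback D ι`. [folklore] -/
theorem apply_genericPoint_mem_U (j : (D.classPullback ι).ι) : ι (genericPoint F) ∈ D.U j.1.1 :=
  j.2.1

/-- The chart of `classPullback D ι` given by a chart `U_c ∋ ι(η_F)` of `D`. [folklore] -/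
def classPullbackChart {c : D.ι} (hc : ι (genericPoint F) ∈ D.U c) : (D.classPullback ι).ι :=
  ⟨(c, PUnit.unit), hc, trivial⟩

/-- `f_j / f_{i₀}` is a unit at `y₀ = ι(η_F)` for the charts `j` of `classPullback D ι`. [folklore] -/
theorem isUnitAt_f_div_f_chartAt {j : D.ι} (hj : ι (genericPoint F) ∈ D.U j) :
    IsUnitAt (ι (genericPoint F)) (D.f j * (D.f (D.chartAt (ι (genericPoint F))))⁻¹) := by
  rw [← div_eq_mul_inv]
  exact D.isUnitAt_div _ _ _ hj (D.mem_U_chartAt _)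

variable {D ι}

/-- For a section `s` of `𝒪_Y(D)` over `W ∋ ι(η_F)`, `f_{i₀} s` is regular at `ι(η_F)`. [folklore] -/
theorem IsSectionOn.isRegularAt_chartAt_mul {W : Set Y} {s : Y.functionField}
    (hs : D.IsSectionOn W s) (hy : ι (genericPoint F) ∈ W) :
    IsRegularAt (ι (genericPoint F)) (D.f (D.chartAt (ι (genericPoint F))) * s) :=
  hs _ _ (D.mem_U_chartAt _) hy

/-- **The restriction along `ι` of a section of `𝒪_Y(D)` over an open `W ∋ ι(η_F)` is a section of
`𝒪_F(D_ι)` over `ι⁻¹W`**: `ι^♯(f_j/f_{i₀}) · ι^♯(f_{i₀} s) = ι^♯(f_j s)` is regular on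
`ι⁻¹(U_j ∩ W)`. [folklore] -/
theorem IsSectionOn.fibreFn {W : Y.Opens} {s : Y.functionField} (hs : D.IsSectionOn W s)
    (hy : ι (genericPoint F) ∈ W) :
    (D.classPullback ι).IsSectionOn (ι ⁻¹ᵁ W) (D.fibreFn ι s) := by
  intro j x hj hx
  rw [classPullback_f, CartierDivisor.fibreFn,
    ← pullbackFn_mul ι (D.isUnitAt_f_div_f_chartAt ι (D.apply_genericPoint_mem_U ι j)).isRegularAt
      (hs.isRegularAt_chartAt_mul hy),
    mul_assoc, inv_mul_cancel_left₀ (D.f_ne_zero _)]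
  exact (hs j.1.1 (ι x) hj.1 hx).pullbackFn

/-- `fibreFn` is additive on sections over `W ∋ ι(η_F)`. [folklore] -/
theorem fibreFn_add {W : Set Y} {s s' : Y.functionField} (hs : D.IsSectionOn W s)
    (hs' : D.IsSectionOn W s') (hy : ι (genericPoint F) ∈ W) :
    D.fibreFn ι (s + s') = D.fibreFn ι s + D.fibreFn ι s' := by
  simp only [CartierDivisor.fibreFn, mul_add]
  exact pullbackFn_add ι (hs.isRegularAt_chartAt_mul hy) (hs'.isRegularAt_chartAt_mul hy)

/-- `fibreFn` is multiplicative with respect to functions regular at `ι(η_F)`: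
`ι^♯(f_{i₀} (a s)) = ι^♯(a) ι^♯(f_{i₀} s)`. [folklore] -/
theorem fibreFn_mul_left {W : Set Y} {a s : Y.functionField}
    (ha : IsRegularAt (ι (genericPoint F)) a) (hs : D.IsSectionOn W s)
    (hy : ι (genericPoint F) ∈ W) :
    D.fibreFn ι (a * s) = pullbackFn ι a * D.fibreFn ι s := by
  simp only [CartierDivisor.fibreFn]
  rw [mul_left_comm, pullbackFn_mul ι ha (hs.isRegularAt_chartAt_mul hy)]

end ChartAt


section Preimage

variable {F Y : Scheme.{u}} [IsIntegral F]

/-- If `ι(η_F) ∉ W` then `ι⁻¹W = ∅` (every point of `F` specialises from `η_F`). [folklore] -/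
theorem preimage_eq_bot_of_notMem (ι : F ⟶ Y) {W : Y.Opens} (hy : ι (genericPoint F) ∉ W) :
    ι ⁻¹ᵁ W = ⊥ :=
  le_bot_iff.1 fun _ hx => hy (genericPoint_mem_of_mem (U := ι ⁻¹ᵁ W) hx)

end Preimage

/-! ### Base change of `Γ(W, 𝒪(D))` to the residue field of a point of the base -/

section FibreSections

variable {K : Type u} [Field K] {X T : SchemeOver K} {t : T.left} [IsIntegral (X ⊗ T).left]
  [IsIntegral (X ⊗ residuePt T t).left] {V : T.left.Opens} (ht : t ∈ V)
  {W : (X ⊗ T).left.Opens} (hWV : W ≤ (snd X T).left ⁻¹ᵁ V)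
  (D : CartierDivisor (X ⊗ T).left) (hVξ : genericPoint (X ⊗ T).left ∈ (snd X T).left ⁻¹ᵁ V)

/-- The structure map `κ(t) → Γ(W', 𝒪_{X_t})` (`fibreSecAlgebra`) followed by "rational function of
a section" is the structure map `κ(t) → K(X_t)` of the `κ(t)`-scheme `X_t`
(`fibreOverResidueField`). [folklore] -/
theorem ofSection_fibreSecAlgebra_algebraMap (X T : SchemeOver K) (t : T.left)
    [IsIntegral (X ⊗ residuePt T t).left] {W' : (X ⊗ residuePt T t).left.Opens}
    (hξ : genericPoint (X ⊗ residuePt T t).left ∈ W') (c : T.left.residueField t) :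
    letI := fibreSecAlgebra X T t W'
    letI := fibreOverResidueField X T t
    ofSection hξ (algebraMap (T.left.residueField t) Γ((X ⊗ residuePt T t).left, W') c) =
      algebraMap (T.left.residueField t) (X ⊗ residuePt T t).left.functionField c := by
  letI := fibreOverResidueField X T t
  change ofSection hξ (((Scheme.ΓSpecIso (T.left.residueField t)).inv ≫
      (fibreStr X T t).appLE ⊤ W' le_top) c) =
    (X ⊗ residuePt T t).left.presheaf.germ ⊤ (genericPoint _) trivial
      ((fibreStr X T t).appTop ((Scheme.ΓSpecIso (T.left.residueField t)).inv c))
  simp only [Scheme.Hom.appLE]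
  exact ofSection_map (homOfLE le_top) hξ _

/-- **Sections of `𝒪_Y(D)` over an affine `W ⊆ X ×_K T`, base-changed to `κ(t)`, are the sections
of `𝒪_{X_t}(D_t)` over `W_t`.** For `V ∋ t` affine, `W ⊆ pr_T⁻¹V ∩ U_c` affine with
`y_t = fibreι(η_{X_t}) ∈ W`, the `κ(t)`-linear isomorphism
`κ(t) ⊗_{Γ(V, 𝒪_T)} Γ(W, 𝒪_Y(D)) ≅ Γ(W_t, 𝒪_{X_t}(D_t))` (`D_t = classPullback D (fibreι X T t)`),
composite of the trivialisation `Γ(W, 𝒪_Y(D)) = f_c⁻¹ Γ(W, 𝒪_Y)` (Görtz–Wedhorn I, (11.9)), the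
affine base change `κ(t) ⊗ Γ(W, 𝒪_Y) ≅ Γ(W_t, 𝒪_{X_t})` (`fibreSectionsEquiv`; Görtz–Wedhorn I,
Prop. 12.6 / II, proof of Thm. 22.90) and the trivialisation
`Γ(W_t, 𝒪_{X_t}(D_t)) = ι^♯(f_c/f_{i₀})⁻¹ Γ(W_t, 𝒪_{X_t})` (Görtz–Wedhorn I, (11.16):
`f^*𝒪(D) ≅ 𝒪(f^*D)`); on elements `c ⊗ s ↦ c · ι^♯(f_{i₀} s)`
(`coe_fibreSectionsOnEquiv_tmul`). [cite: GortzWedhorn2020, Section (11.16) (p. 392) with Prop. 12.6 (p. 405)] -/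
def fibreSectionsOnEquiv (hV : IsAffineOpen V) (hW : IsAffineOpen W) {c : D.ι} (hWc : W ≤ D.U c)
    (hy : fibreι X T t (genericPoint _) ∈ W) :
    letI := CartierDivisor.baseAlgebra (snd X T).left V hVξ
    letI := evalAlgebra T t ht
    letI := fibreOverResidueField X T t
    T.left.residueField t ⊗[Γ(T.left, V)] D.sectionsOn W (fun a _ hx =>
        isRegularAt_baseAlgebra_algebraMap (snd X T).left V hVξ a (hWV hx)) ≃ₗ[T.left.residueField t]
      (D.classPullback (fibreι X T t)).sectionsOn (A := T.left.residueField t)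
        (fibreι X T t ⁻¹ᵁ W) (fun c _ _ => isRegularAt_algebraMap _ c) := by
  letI := CartierDivisor.baseAlgebra (snd X T).left V hVξ
  letI := evalAlgebra T t ht
  letI := fibreOverResidueField X T t
  letI := prSecAlgebra X T hWV
  letI := fibreSecAlgebra X T t (fibreι X T t ⁻¹ᵁ W)
  have hξW : genericPoint (X ⊗ T).left ∈ W := genericPoint_mem_of_mem hy
  have hξ' : genericPoint (X ⊗ residuePt T t).left ∈ fibreι X T t ⁻¹ᵁ W := hy
  refine (LinearEquiv.baseChange Γ(T.left, V) (T.left.residueField t) _ _ (D.sectionsOnEquiv hξW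
    hWc (ofSection_secAlgebra_algebraMap (snd X T).left V hVξ W hWV hξW) _).symm).trans
    ((fibreSectionsEquiv ht hWV hV hW).toLinearEquiv.trans
      ((D.classPullback (fibreι X T t)).sectionsOnEquiv hξ'
        (i := D.classPullbackChart (fibreι X T t) (hWc hy))
        (fun x hx => ⟨hWc hx, trivial⟩) (ofSection_fibreSecAlgebra_algebraMap X T t hξ') _))

/-- **`fibreSectionsOnEquiv (c ⊗ s) = c · ι^♯(f_{i₀} s)`** (`CartierDivisor.fibreFn`): the
isomorphism does not depend on `W` or on the chart `c` — it is the restriction of rational sections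
to the fibre. [folklore] -/
theorem coe_fibreSectionsOnEquiv_tmul (hV : IsAffineOpen V) (hW : IsAffineOpen W) {c : D.ι}
    (hWc : W ≤ D.U c) (hy : fibreι X T t (genericPoint _) ∈ W) (c' : T.left.residueField t)
    (s : letI := CartierDivisor.baseAlgebra (snd X T).left V hVξ
      D.sectionsOn W (fun a _ hx =>
        isRegularAt_baseAlgebra_algebraMap (snd X T).left V hVξ a (hWV hx))) :
    letI := CartierDivisor.baseAlgebra (snd X T).left V hVξ
    letI := evalAlgebra T t ht
    letI := fibreOverResidueField X T t
    ((D.fibreSectionsOnEquiv ht hWV hVξ hV hW hWc hy (c' ⊗ₜ s) :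
        (D.classPullback (fibreι X T t)).sectionsOn (A := T.left.residueField t)
          (fibreι X T t ⁻¹ᵁ W) (fun c _ _ => isRegularAt_algebraMap _ c)) :
      (X ⊗ residuePt T t).left.functionField) = c' • D.fibreFn (fibreι X T t) s := by
  letI := CartierDivisor.baseAlgebra (snd X T).left V hVξ
  letI := evalAlgebra T t ht
  letI := fibreOverResidueField X T t
  letI := prSecAlgebra X T hWV
  letI := fibreSecAlgebra X T t (fibreι X T t ⁻¹ᵁ W)
  have hξW : genericPoint (X ⊗ T).left ∈ W := genericPoint_mem_of_mem hy
  have hξ' : genericPoint (X ⊗ residuePt T t).left ∈ fibreι X T t ⁻¹ᵁ W := hy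
  set e₀ := D.sectionsOnEquiv hξW hWc
    (ofSection_secAlgebra_algebraMap (snd X T).left V hVξ W hWV hξW)
    (fun a _ hx => isRegularAt_baseAlgebra_algebraMap (snd X T).left V hVξ a (hWV hx)) with he₀
  obtain ⟨g, rfl⟩ := e₀.surjective s
  simp only [fibreSectionsOnEquiv, LinearEquiv.trans_apply]
  rw [← he₀, LinearEquiv.baseChange_tmul, LinearEquiv.symm_apply_apply, AlgEquiv.toLinearEquiv_apply,
    fibreSectionsEquiv_tmul, coe_sectionsOnEquiv, he₀, coe_sectionsOnEquiv, classPullback_f,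
    Algebra.smul_def]
  have hmul : ofSection hξ' (algebraMap (T.left.residueField t) _ c' *
      (fibreι X T t).appLE W (fibreι X T t ⁻¹ᵁ W) le_rfl g) =
      algebraMap (T.left.residueField t) (X ⊗ residuePt T t).left.functionField c' *
        pullbackFn (fibreι X T t) (ofSection hξW g) := by
    rw [← ofSection_fibreSecAlgebra_algebraMap X T t hξ' c',
      ← ofSection_appLE (fibreι X T t) (le_refl _) hξ' g]
    exact map_mul _ _ _
  rw [hmul, mul_assoc]
  congr 1
  -- the rational identity `ι^♯(g) / ι^♯(f_c/f_{i₀}) = ι^♯(f_{i₀} (g / f_c))`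
  have hu := D.isUnitAt_f_div_f_chartAt (fibreι X T t) (hWc hy)
  have hg : IsRegularAt (fibreι X T t (genericPoint _)) (ofSection hξW g) :=
    isRegularAt_ofSection hy g
  dsimp only [classPullbackChart]
  rw [CartierDivisor.fibreFn, ← pullbackFn_inv _ hu, ← pullbackFn_mul _ hg hu.inv.isRegularAt]
  congr 1
  field_simp [D.f_ne_zero c, D.f_ne_zero (D.chartAt (fibreι X T t (genericPoint _)))]

/-- If `y_t = fibreι(η_{X_t}) ∉ W` (i.e. `W_t = ∅`) then `κ(t) ⊗_{Γ(V, 𝒪_T)} Γ(W, 𝒪_Y(D)) = 0`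
(`≅ Γ(∅, 𝒪_{X_t})`). [folklore] -/
theorem subsingleton_tensorProduct_sectionsOn (hV : IsAffineOpen V) (hW : IsAffineOpen W)
    {c : D.ι} (hWc : W ≤ D.U c) (hξW : genericPoint (X ⊗ T).left ∈ W)
    (hy : fibreι X T t (genericPoint _) ∉ W) :
    letI := CartierDivisor.baseAlgebra (snd X T).left V hVξ
    letI := evalAlgebra T t ht
    Subsingleton (T.left.residueField t ⊗[Γ(T.left, V)] D.sectionsOn W (fun a _ hx =>
        isRegularAt_baseAlgebra_algebraMap (snd X T).left V hVξ a (hWV hx))) := by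
  letI := CartierDivisor.baseAlgebra (snd X T).left V hVξ
  letI := evalAlgebra T t ht
  letI := prSecAlgebra X T hWV
  letI := fibreSecAlgebra X T t (fibreι X T t ⁻¹ᵁ W)
  have hbot : fibreι X T t ⁻¹ᵁ W = ⊥ := preimage_eq_bot_of_notMem _ hy
  haveI : Subsingleton Γ((X ⊗ residuePt T t).left, fibreι X T t ⁻¹ᵁ W) :=
    CommRingCat.subsingleton_of_isTerminal
      ((X ⊗ residuePt T t).left.sheaf.isTerminalOfEqEmpty (by rw [hbot]))
  exact ((LinearEquiv.baseChange Γ(T.left, V) (T.left.residueField t) _ _ (D.sectionsOnEquiv hξW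
    hWc (ofSection_secAlgebra_algebraMap (snd X T).left V hVξ W hWV hξW) _).symm).trans
    (fibreSectionsEquiv ht hWV hV hW).toLinearEquiv).toEquiv.subsingleton

end FibreSections

end CartierDivisor

end Literature.AlgebraicGeometry.Motives

end
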